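import Summits.Ventures.PercRepro.C026ThreeFactorTwo
import Summits.Ventures.PercRepro.C026EqualityLocusStrict

/-!
# The equality locus of (★) on the 6-vertex gadget (p5, gen 14)

mine-3's Theorem E (iii) on p5's gadget class: on every multigraph supported on six vertices (marks
`ι 0, ι 1, ι 2`, non-marks `ι 3, ι 4, ι 5`) with every edge at a non-mark — every multigraph with at most
three non-marks and no mark–mark edge — the D-free inequality is STRICT exactly when `CSeparated` fails:
the equality locus of (★) is `{G : CSeparated (ι 0) (ι 1) (ι 2)}`, i.e. mine-3's `F2`. The factor-2 form
`factorTwo_of_supported6'` (from the kernel table `Plane6.tableF2`) supplies the no-cancellation half.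
-/

namespace PercRepro

open Finset

namespace MultiGraph

section ThreeLocus

variable {V E : Type*} {G : MultiGraph V E} {ι : ℕ → V}

/-- Two of the six supported vertices are distinct. -/
theorem InjBelow.ne_of_lt6 (hinj : InjBelow ι 6) {i j : ℕ} (hi : i < 6) (hj : j < 6) (hij : i ≠ j) :
    ι i ≠ ι j := fun h => hij (hinj i hi j hj h)

/-- With every edge at a non-mark, no edge joins two marks. -/
theorem not_openAdj_full_marks (hinj : InjBelow ι 6)
    (hnm : ∀ e, ∃ k, 3 ≤ k ∧ k < 6 ∧ (G.fst e = ι k ∨ G.snd e = ι k)) {i j : ℕ} (hi : i < 3)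
    (hj : j < 3) : ¬ G.OpenAdj (fullConfig (E := E)) (ι i) (ι j) := by
  rintro ⟨e, _, hj'⟩
  obtain ⟨k, hk3, hk6, hk⟩ := hnm e
  have hki : k ≠ i := by omega
  have hkj : k ≠ j := by omega
  rcases hj' with ⟨h1, h2⟩ | ⟨h1, h2⟩ <;> rcases hk with hk | hk
  · exact hki (hinj k hk6 i (by omega) (hk.symm.trans h1))
  · exact hkj (hinj k hk6 j (by omega) (hk.symm.trans h2))
  · exact hkj (hinj k hk6 j (by omega) (hk.symm.trans h1))
  · exact hki (hinj k hk6 i (by omega) (hk.symm.trans h2))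

variable (hinj : InjBelow ι 6)
variable (hnm : ∀ e, ∃ k, 3 ≤ k ∧ k < 6 ∧ (G.fst e = ι k ∨ G.snd e = ι k))
variable (hsup : G.Supported ι 6)
include hinj hnm hsup

open Classical in
/-- **The equality locus of (★) on the 6-vertex gadget (Theorem E (iii))**: the D-free inequality
`#{bot : a ~_H b} ≤ #O1 + #O2` is strict iff `CSeparated (ι 0) (ι 1) (ι 2)` fails — i.e. it is an equality
exactly when the component of the mark `ι 2` in the underlying graph avoids `ι 0` and `ι 1`. -/
theorem dFree_strict_iff_of_supported6 [Fintype E] :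
    ((univ.filter fun ω : Config E => G.BotM ω (ι 0) (ι 1) (ι 2)).card <
      (univ.filter fun ω : Config E => G.O1 ω (ι 0) (ι 1) (ι 2)).card +
        (univ.filter fun ω : Config E => G.O2 ω (ι 0) (ι 1) (ι 2)).card) ↔
      ¬ G.CSeparated (ι 0) (ι 1) (ι 2) := by
  constructor
  · intro hlt hsep
    obtain ⟨h0, h1, h2⟩ := dFree_counts_eq_zero_of_cSeparated (G := G) hsep
    rw [h0, h1, h2] at hlt
    omega
  · intro hns
    exact dFree_strict_of_not_cSeparated (hinj.ne_of_lt6 (by omega) (by omega) (by omega))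
      (hinj.ne_of_lt6 (by omega) (by omega) (by omega)) (hinj.ne_of_lt6 (by omega) (by omega) (by omega))
      (not_openAdj_full_marks hinj hnm (by omega) (by omega))
      (not_openAdj_full_marks hinj hnm (by omega) (by omega))
      (factorTwo_of_supported6' hinj hnm hsup) hns

open Classical in
/-- **Equality in (★) on the 6-vertex gadget iff `CSeparated`** (the complementary form). -/
theorem dFree_eq_iff_of_supported6 [Fintype E] :
    ((univ.filter fun ω : Config E => G.BotM ω (ι 0) (ι 1) (ι 2)).card =
      (univ.filter fun ω : Config E => G.O1 ω (ι 0) (ι 1) (ι 2)).card +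
        (univ.filter fun ω : Config E => G.O2 ω (ι 0) (ι 1) (ι 2)).card) ↔
      G.CSeparated (ι 0) (ι 1) (ι 2) := by
  have hstrict := dFree_strict_iff_of_supported6 hinj hnm hsup
  constructor
  · intro heq
    by_contra hns
    have := hstrict.2 hns
    omega
  · intro hsep
    obtain ⟨h0, h1, h2⟩ := dFree_counts_eq_zero_of_cSeparated (G := G) hsep
    rw [h0, h1, h2]

end ThreeLocus

end MultiGraph

end PercRepro
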